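import Summits.CriticalPhenomena.PercolationContinuityZ3.Theorems.PercNearOneGluingNoHeavyQuantFlowPieces
import Summits.CriticalPhenomena.PercolationContinuityZ3.Theorems.PercNearOneGluingNoHeavyQuantCornerPrelims
import Summits.CriticalPhenomena.PercolationContinuityZ3.Theorems.PercNearOneGluingNoHeavyQuantGatedConvSplit
import HarnessLib

/-!
# QUANT lane R8, T-DEC: the PARTIAL FLOW of the one-layer gated-shift theorem — the nonzero lows of `gate_q(μ(· − 1))` are shipped
# into mids (transported pairs and the gate-zero's slots), and what is left either fits into the giants or is nothing
# (part 2 of 3 for Conjecture R `LawDec.GatedShiftDEC`)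

builds on p205010 (kernel theorem, internal audit signed; external expert review pending)

Support file (`--supports stmt-CriticalPhenomena-4575`), QUANT lane typer seat prim-quant-stmt (gen 26), rung R8 of
`run/shared/lean/prim/quant/LADDER.md`.  One theorem, standard axioms, no sorries.  Uses part 1 (`…QuantFlowPieces`: `usage_slot_le`,
`sum_range_ite_ge_eq_Ico`), typer g25's `usage_shift_le` (`…QuantGatedShiftRates`) and the flow normal form (`LawDec.IsFlowAtT`).

SETTING.  `0 < y < 1`, `0 < q ≤ 1`; `μ ≥ 0` on `{0..M}`, `y·M ≤ S`, `J < M`; `f` a flow witness of `ν = gate_q μ` at `(y, S, J)`.  The shifted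
law `L = gate_q(μ(· − 1))` (`L 0 = 1 − q`, `L (h+1) = q·μ h`) is studied at `(y, S + q, J + 1)`: its NONZERO LOWS are the `a` with
`1 ≤ a ≤ J + 1`, `2a < S + q` (then `a − 1` is a `ν`-low, or `a = 1`).
THE PARTIAL FLOW `φ` (`LawDec.gatedShift_partial`).  (i) the mid pairs of `f` shifted: `φ (l+1) (m+1) ∋ f l m` for a `ν`-mid `m ≤ J`
(cheaper after the shift: `usage_shift_le`); (ii) the giant-bound mass `R a` of each nonzero low `a` (`R (l+1) = Σ_{h > J} f l h`,
`R 1 = q·μ 0`), of total `Q`, is sent into the SLOTS `m + 1` of the mids `m` used by the gate-zero of `ν` (`f 0 m`, total `z_mid`),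
proportionally: `a` ships `R a·f 0 m / max(Q, z_mid)` to `m + 1` (cheaper than what the gate-zero paid: `usage_slot_le`).  CONCLUSIONS
(the six conjuncts): `φ ≥ 0`; its charged pairs are (nonzero low, admissible absorber); it vanishes off the nonzero lows and off the
columns `1..J+1`; every column `m + 1` of `φ` is loaded by at most the `f`-load of `m`; every nonzero low ships at most its mass; and the
DICHOTOMY: either (slots full, `z_mid ≤ Q`) the unplaced low mass plus the gate-zero `1 − q` fits into the certified giant room,
`y/(1−y)·((1 − q) + Σ_a (L a − Σ_k φ a k)) ≤ Σ_{J < h ≤ M} ν h`, or (`Q < z_mid`) every nonzero low is fully placed.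
Part 3 (`…QuantGatedShiftOneLayer`) adds a flow of the remainder by criterion E resp. the first-moment criterion.

[this work]; flow normal form / rates: this lane (typer g22, lead g21, typer g25).  The gluing rows served
[cite: KozmaNitzan2024, Conjecture 3 (p. 15)]; product measure [cite: Grimmett1999, §1.3 p. 10].
-/

noncomputable section

namespace Summit.CriticalPhenomena.PercolationContinuityZ3.Theorems

namespace Quant

open Finset

namespace LawDec

/-! ### The partial flow -/

/-- **THE PARTIAL FLOW OF THE GATED SHIFT.**  See the file header: from a flow witness `f` of `gate μ q` at `(y, S, J)`, a partial flow
`φ` of the nonzero lows of `gate (μ(· − 1)) q` at `(y, S + q, J + 1)` into mids, with column loads dominated by those of `f`, and the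
dichotomy "the rest fits into the giants" / "nothing is left of the nonzero lows". [this work] -/
theorem gatedShift_partial (y S q : ℝ) (J M : ℕ) (μ : ℕ → ℝ) (f : ℕ → ℕ → ℝ) (hy0 : 0 < y) (hy1 : y < 1)
    (hq0 : 0 < q) (hq1 : q ≤ 1) (hμ0 : ∀ h, 0 ≤ μ h) (hta : y * (M : ℝ) ≤ S) (hJM : J < M)
    (hf : IsFlowAtT y S J M (gate μ q) f) :
    ∃ φ : ℕ → ℕ → ℝ,
      (∀ a k, 0 ≤ φ a k) ∧
      (∀ a k, 0 < φ a k → a ≤ J + 1 ∧ 2 * (a : ℝ) < S + q ∧ k ≤ M + 1 ∧ (J + 1 + 1 ≤ k ∨ S + q < (a : ℝ) + k)) ∧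
      (∀ a k, ¬ ((1 ≤ a ∧ a ≤ J + 1 ∧ 2 * (a : ℝ) < S + q) ∧ 1 ≤ k ∧ k ≤ J + 1) → φ a k = 0) ∧
      (∀ m, m ≤ J → ∑ a ∈ Finset.range (J + 1 + 1), usage y (S + q) (J + 1) a (m + 1) * φ a (m + 1)
        ≤ ∑ l ∈ Finset.range (J + 1), usage y S J l m * f l m) ∧
      (∀ a, (1 ≤ a ∧ a ≤ J + 1 ∧ 2 * (a : ℝ) < S + q) →
        ∑ k ∈ Finset.range (M + 1 + 1), φ a k ≤ gate (fun t => if 1 ≤ t then μ (t - 1) else 0) q a) ∧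
      ((y / (1 - y) * ((1 - q) + ∑ a ∈ Finset.range (J + 1 + 1),
          (if (1 ≤ a ∧ a ≤ J + 1 ∧ 2 * (a : ℝ) < S + q) then
            gate (fun t => if 1 ≤ t then μ (t - 1) else 0) q a - ∑ k ∈ Finset.range (M + 1 + 1), φ a k else 0))
          ≤ ∑ h ∈ Finset.Ico (J + 1) (M + 1), gate μ q h) ∨
       (∀ a, (1 ≤ a ∧ a ≤ J + 1 ∧ 2 * (a : ℝ) < S + q) →
          ∑ k ∈ Finset.range (M + 1 + 1), φ a k = gate (fun t => if 1 ≤ t then μ (t - 1) else 0) q a)) := by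
  classical
  have hterm := hf.term_nonneg hy0 hy1
  obtain ⟨hf0, hsupp, hrow, hcap⟩ := hf
  set S' : ℝ := S + q with hS'
  set ν : ℕ → ℝ := gate μ q with hν
  set sh : ℕ → ℝ := fun t => if 1 ≤ t then μ (t - 1) else 0 with hsh
  set L : ℕ → ℝ := gate sh q with hL
  set uy : ℝ := y / (1 - y) with huy
  /- ### scalars, values of `ν` and `L`, facts about `f` -/
  have h1y : 0 < 1 - y := by linarith
  have huy0 : 0 < uy := div_pos hy0 h1y
  have hM1 : (1 : ℝ) ≤ M := by exact_mod_cast (show 1 ≤ M by omega)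
  have hSpos : 0 < S := by nlinarith
  have hq2 : q ≤ 2 := by linarith
  have hνval : ∀ h, ν h = q * μ h + (1 - q) * (if h = 0 then (1 : ℝ) else 0) := fun h => by rw [hν, gate_apply]
  have hν0 : ν 0 = 1 - q + q * μ 0 := by rw [hνval, if_pos rfl]; ring
  have hνpos : ∀ h, 1 ≤ h → ν h = q * μ h := fun h hh => by rw [hνval, if_neg (by omega)]; ring
  have hLsucc : ∀ h, L (h + 1) = q * μ h := fun h => by
    rw [hL, gate_apply]; simp only [hsh]; rw [if_pos (by omega), if_neg (by omega), Nat.add_sub_cancel]; ring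
  have hlh : ∀ l h, 0 < f l h → l < h := by
    intro l h hp
    obtain ⟨_, hlow, _, hadm⟩ := hsupp l h hp
    rcases hadm with h1 | h2
    · omega
    · by_contra hc
      have : (h : ℝ) ≤ l := by exact_mod_cast not_lt.1 hc
      linarith [(Nat.cast_nonneg l : (0 : ℝ) ≤ l)]
  have hrow0 : ∑ h ∈ Finset.range (M + 1), f 0 h = ν 0 := hrow 0 (Nat.zero_le J) (by simpa using hSpos)
  /- ### the pieces -/
  set mid : ℕ → ℕ → ℝ := fun a k =>
    if (1 ≤ a ∧ a ≤ J + 1 ∧ 2 * (a : ℝ) < S') ∧ 2 ≤ a ∧ 1 ≤ k ∧ k ≤ J + 1 then f (a - 1) (k - 1) else 0 with hmid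
  set slot : ℕ → ℝ := fun k => if 1 ≤ k ∧ k ≤ J + 1 then f 0 (k - 1) else 0 with hslot
  set zmid : ℝ := ∑ k ∈ Finset.range (M + 1 + 1), slot k with hzmid
  set R : ℕ → ℝ := fun a =>
    if (1 ≤ a ∧ a ≤ J + 1 ∧ 2 * (a : ℝ) < S') then L a - ∑ k ∈ Finset.range (M + 1 + 1), mid a k else 0 with hR
  set Q : ℝ := ∑ a ∈ Finset.range (J + 1 + 1), R a with hQ
  set D : ℝ := max Q zmid with hD
  set ρ : ℕ → ℝ := fun a => R a / D with hρ
  set φ : ℕ → ℕ → ℝ := fun a k =>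
    mid a k + (if (1 ≤ a ∧ a ≤ J + 1 ∧ 2 * (a : ℝ) < S') then ρ a * slot k else 0) with hφ
  have hslot0 : ∀ k, 0 ≤ slot k := fun k => by simp only [hslot]; split_ifs; exacts [hf0 _ _, le_rfl]
  have hzmid0 : 0 ≤ zmid := by rw [hzmid]; exact Finset.sum_nonneg fun k _ => hslot0 k
  have hzG : ∑ h ∈ Finset.Ico (J + 1) (M + 1), f 0 h = ν 0 - zmid := by
    rw [← sum_range_ite_ge_eq_Ico, ← hrow0, hzmid]
    simp only [hslot]
    rw [Finset.sum_range_succ' (fun k => if 1 ≤ k ∧ k ≤ J + 1 then f 0 (k - 1) else 0), if_neg (by omega), add_zero,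
      ← Finset.sum_sub_distrib]
    refine Finset.sum_congr rfl fun h _ => ?_
    by_cases hh : J + 1 ≤ h
    · rw [if_pos hh, if_neg (by omega), sub_zero]
    · rw [if_neg hh, if_pos ⟨by omega, by omega⟩, Nat.add_sub_cancel, sub_self]
  have hmid0 : ∀ a k, 0 ≤ mid a k := fun a k => by simp only [hmid]; split_ifs; exacts [hf0 _ _, le_rfl]
  have hmid_row : ∀ a, (1 ≤ a ∧ a ≤ J + 1 ∧ 2 * (a : ℝ) < S') → 2 ≤ a →
      ∑ k ∈ Finset.range (M + 1 + 1), mid a k = ∑ h ∈ Finset.range (M + 1), (if h ≤ J then f (a - 1) h else 0) := by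
    intro a hla ha2
    simp only [hmid]
    rw [Finset.sum_range_succ']
    rw [if_neg (fun hc => absurd hc.2.2.1 (by omega)), add_zero]
    refine Finset.sum_congr rfl fun h _ => ?_
    by_cases hh : h ≤ J
    · rw [if_pos ⟨hla, ha2, by omega, by omega⟩, if_pos hh, Nat.add_sub_cancel]
    · rw [if_neg (fun hc => hh (Nat.le_of_succ_le_succ hc.2.2.2)), if_neg hh]
  have hLa : ∀ a, (1 ≤ a ∧ a ≤ J + 1 ∧ 2 * (a : ℝ) < S') → 2 ≤ a →
      L a = ∑ h ∈ Finset.range (M + 1), f (a - 1) h := by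
    intro a hla ha2
    obtain ⟨l, rfl⟩ : ∃ l, a = l + 1 := ⟨a - 1, by omega⟩
    rw [Nat.add_sub_cancel, hLsucc, ← hνpos l (by omega)]
    refine (hrow l (by omega) ?_).symm
    have : ((l + 1 : ℕ) : ℝ) = (l : ℝ) + 1 := by push_cast; ring
    rw [this] at hla
    rw [hS'] at hla
    linarith [hla.2.2]
  have hR2 : ∀ a, (1 ≤ a ∧ a ≤ J + 1 ∧ 2 * (a : ℝ) < S') → 2 ≤ a →
      R a = ∑ h ∈ Finset.range (M + 1), (if J + 1 ≤ h then f (a - 1) h else 0) := by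
    intro a hla ha2
    simp only [hR]
    rw [if_pos hla, hmid_row a hla ha2, hLa a hla ha2, ← Finset.sum_sub_distrib]
    refine Finset.sum_congr rfl fun h _ => ?_
    by_cases hh : h ≤ J
    · rw [if_pos hh, if_neg (by omega), sub_self]
    · rw [if_neg hh, if_pos (by omega), sub_zero]
  have hR1 : (1 ≤ 1 ∧ 1 ≤ J + 1 ∧ 2 * ((1 : ℕ) : ℝ) < S') → R 1 = q * μ 0 := by
    intro hla
    simp only [hR]
    rw [if_pos hla, Finset.sum_eq_zero (fun k _ => by
      simp only [hmid]; rw [if_neg (fun hc => absurd hc.2.1 (by omega))]), sub_zero]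
    exact hLsucc 0
  have hRz : ∀ a, ¬ (1 ≤ a ∧ a ≤ J + 1 ∧ 2 * (a : ℝ) < S') → R a = 0 := fun a ha => by
    simp only [hR]; rw [if_neg ha]
  have hR0 : ∀ a, 0 ≤ R a := by
    intro a
    by_cases hla : (1 ≤ a ∧ a ≤ J + 1 ∧ 2 * (a : ℝ) < S')
    · by_cases ha2 : 2 ≤ a
      · rw [hR2 a hla ha2]; exact Finset.sum_nonneg fun h _ => by split_ifs; exacts [hf0 _ _, le_rfl]
      · obtain rfl : a = 1 := by omega
        rw [hR1 hla]; exact mul_nonneg hq0.le (hμ0 0)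
    · rw [hRz a hla]
  have hQ0 : 0 ≤ Q := by rw [hQ]; exact Finset.sum_nonneg fun a _ => hR0 a
  have hQD : Q ≤ D := le_max_left _ _
  have hzD : zmid ≤ D := le_max_right _ _
  have hD0 : 0 ≤ D := le_trans hQ0 hQD
  have hρ0 : ∀ a, 0 ≤ ρ a := fun a => by simp only [hρ]; exact div_nonneg (hR0 a) hD0
  have hρz : ∀ a, ¬ (1 ≤ a ∧ a ≤ J + 1 ∧ 2 * (a : ℝ) < S') → ρ a = 0 := fun a ha => by
    simp only [hρ]; rw [hRz a ha, zero_div]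
  have hρsum : ∑ a ∈ Finset.range (J + 1 + 1), ρ a = Q / D := by
    simp only [hρ]; rw [← Finset.sum_div]
  have hQD1 : Q / D ≤ 1 := by
    rcases hD0.eq_or_lt with hz | hpos
    · rw [← hz, div_zero]; exact zero_le_one
    · exact (div_le_one hpos).2 hQD
  have hρz_le : ∀ a, ρ a * zmid ≤ R a := by
    intro a
    simp only [hρ]
    rcases hD0.eq_or_lt with hz | hpos
    · rw [← hz, div_zero, zero_mul]; exact hR0 a
    · rw [div_mul_eq_mul_div, div_le_iff₀ hpos]
      exact mul_le_mul_of_nonneg_left hzD (hR0 a)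
  have hφ0 : ∀ a k, 0 ≤ φ a k := fun a k => by
    simp only [hφ]
    refine add_nonneg (hmid0 a k) ?_
    split_ifs
    · exact mul_nonneg (hρ0 a) (hslot0 k)
    · exact le_rfl
  have hφpos : ∀ a k, 0 < φ a k → (1 ≤ a ∧ a ≤ J + 1 ∧ 2 * (a : ℝ) < S') ∧ 1 ≤ k ∧ k ≤ J + 1 ∧ k - 1 ≤ M ∧
      ((2 ≤ a ∧ 0 < f (a - 1) (k - 1)) ∨ (0 < f 0 (k - 1) ∧ S < (((k - 1 : ℕ) : ℝ)))) := by
    intro a k hp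
    simp only [hφ] at hp
    by_cases hm : 0 < mid a k
    · simp only [hmid] at hm
      by_cases hc : (1 ≤ a ∧ a ≤ J + 1 ∧ 2 * (a : ℝ) < S') ∧ 2 ≤ a ∧ 1 ≤ k ∧ k ≤ J + 1
      · rw [if_pos hc] at hm
        obtain ⟨_, _, hkM, _⟩ := hsupp _ _ hm
        exact ⟨hc.1, hc.2.2.1, hc.2.2.2, hkM, Or.inl ⟨hc.2.1, hm⟩⟩
      · rw [if_neg hc] at hm; exact absurd hm (lt_irrefl 0)
    · have hm0' : mid a k = 0 := le_antisymm (not_lt.1 hm) (hmid0 a k)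
      rw [hm0', zero_add] at hp
      by_cases hla : (1 ≤ a ∧ a ≤ J + 1 ∧ 2 * (a : ℝ) < S')
      · rw [if_pos hla] at hp
        have hs : 0 < slot k := by
          by_contra hle
          have : slot k = 0 := le_antisymm (not_lt.1 hle) (hslot0 k)
          rw [this, mul_zero] at hp; exact lt_irrefl _ hp
        simp only [hslot] at hs
        by_cases hk : 1 ≤ k ∧ k ≤ J + 1
        · rw [if_pos hk] at hs
          obtain ⟨_, _, hkM, hadm⟩ := hsupp 0 (k - 1) hs
          have hSk : S < ((k - 1 : ℕ) : ℝ) := by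
            rcases hadm with h1 | h2
            · omega
            · simpa using h2
          exact ⟨hla, hk.1, hk.2, hkM, Or.inr ⟨hs, hSk⟩⟩
        · rw [if_neg hk] at hs; exact absurd hs (lt_irrefl 0)
      · rw [if_neg hla] at hp; exact absurd hp (lt_irrefl 0)
  have hφsupp : ∀ a k, 0 < φ a k → a ≤ J + 1 ∧ 2 * (a : ℝ) < S' ∧ k ≤ M + 1 ∧ (J + 1 + 1 ≤ k ∨ S' < (a : ℝ) + k) := by
    intro a k hp
    obtain ⟨hla, hk1, hkJ, hkM, hcase⟩ := hφpos a k hp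
    have hkcast : (((k - 1 : ℕ) : ℝ)) = (k : ℝ) - 1 := by push_cast [Nat.cast_sub hk1]; ring
    have ha1 : (1 : ℝ) ≤ a := by exact_mod_cast hla.1
    refine ⟨hla.2.1, hla.2.2, by omega, Or.inr ?_⟩
    rcases hcase with ⟨ha2, hfp⟩ | ⟨hfp, hSk⟩
    · obtain ⟨_, _, _, hadm⟩ := hsupp _ _ hfp
      rcases hadm with h1 | h2
      · omega
      · have hacast : (((a - 1 : ℕ) : ℝ)) = (a : ℝ) - 1 := by push_cast [Nat.cast_sub hla.1]; ring
        rw [hacast, hkcast] at h2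
        rw [hS']; linarith
    · rw [hkcast] at hSk
      rw [hS']; linarith
  have hφz : ∀ a k, ¬ ((1 ≤ a ∧ a ≤ J + 1 ∧ 2 * (a : ℝ) < S') ∧ 1 ≤ k ∧ k ≤ J + 1) → φ a k = 0 := by
    intro a k hn
    by_contra hne
    have hp : 0 < φ a k := lt_of_le_of_ne (hφ0 a k) (Ne.symm hne)
    obtain ⟨hla, hk1, hkJ, _, _⟩ := hφpos a k hp
    exact hn ⟨hla, hk1, hkJ⟩
  have hrowφ : ∀ a, (1 ≤ a ∧ a ≤ J + 1 ∧ 2 * (a : ℝ) < S') →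
      L a - ∑ k ∈ Finset.range (M + 1 + 1), φ a k = R a - ρ a * zmid := by
    intro a hla
    have hsplit : ∑ k ∈ Finset.range (M + 1 + 1), φ a k = ∑ k ∈ Finset.range (M + 1 + 1), mid a k + ρ a * zmid := by
      simp only [hφ]
      rw [Finset.sum_add_distrib]
      simp only [if_pos hla]
      rw [← Finset.mul_sum]
    rw [hsplit]
    have : R a = L a - ∑ k ∈ Finset.range (M + 1 + 1), mid a k := by simp only [hR]; rw [if_pos hla]
    rw [this]; ring
  have hcolφ : ∀ m, m ≤ J → ∑ a ∈ Finset.range (J + 1 + 1), usage y S' (J + 1) a (m + 1) * φ a (m + 1)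
      ≤ ∑ l ∈ Finset.range (J + 1), usage y S J l m * f l m := by
    intro m hmJ
    have hT1 : ∑ a ∈ Finset.range (J + 1 + 1), usage y S' (J + 1) a (m + 1) * mid a (m + 1)
        ≤ ∑ l ∈ Finset.range (J + 1), (if 1 ≤ l then usage y S J l m * f l m else 0) := by
      rw [Finset.sum_range_succ']
      have hz : usage y S' (J + 1) 0 (m + 1) * mid 0 (m + 1) = 0 := by
        simp only [hmid]; rw [if_neg (by omega), mul_zero]
      rw [hz, add_zero]
      refine Finset.sum_le_sum fun l hl => ?_
      rw [Finset.mem_range] at hl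
      simp only [hmid, Nat.add_sub_cancel]
      by_cases hc : (1 ≤ l + 1 ∧ l + 1 ≤ J + 1 ∧ 2 * ((l + 1 : ℕ) : ℝ) < S') ∧ 2 ≤ l + 1 ∧ 1 ≤ m + 1 ∧ m + 1 ≤ J + 1
      · rw [if_pos hc, if_pos (Nat.le_of_succ_le_succ hc.2.1)]
        rcases (hf0 l m).eq_or_lt with hz' | hp
        · rw [← hz', mul_zero, mul_zero]
        · obtain ⟨_, hlow, _, hadm⟩ := hsupp l m hp
          have hus := usage_shift_le y S q J 1 l m hy0 hy1 hq2 hlow (hlh l m hp) hadm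
          simp only [Nat.cast_one, mul_one] at hus
          exact mul_le_mul_of_nonneg_right hus hp.le
      · rw [if_neg hc, mul_zero]
        split_ifs
        · exact hterm l m
        · exact le_rfl
    have hT2 : ∑ a ∈ Finset.range (J + 1 + 1), usage y S' (J + 1) a (m + 1) *
          (if (1 ≤ a ∧ a ≤ J + 1 ∧ 2 * (a : ℝ) < S') then ρ a * slot (m + 1) else 0)
        ≤ usage y S J 0 m * f 0 m := by
      have hsl : slot (m + 1) = f 0 m := by
        simp only [hslot]; rw [if_pos ⟨by omega, by omega⟩, Nat.add_sub_cancel]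
      have hbd : ∀ a ∈ Finset.range (J + 1 + 1), usage y S' (J + 1) a (m + 1) *
          (if (1 ≤ a ∧ a ≤ J + 1 ∧ 2 * (a : ℝ) < S') then ρ a * slot (m + 1) else 0)
            ≤ ρ a * (usage y S J 0 m * f 0 m) := by
        intro a _
        rw [hsl]
        by_cases hla : (1 ≤ a ∧ a ≤ J + 1 ∧ 2 * (a : ℝ) < S')
        · rw [if_pos hla]
          rcases (hf0 0 m).eq_or_lt with hz' | hp
          · rw [← hz']; simp
          · obtain ⟨_, _, _, hadm⟩ := hsupp 0 m hp
            have hSm : S < (m : ℝ) := by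
              rcases hadm with h1 | h2
              · omega
              · simpa using h2
            have hus := usage_slot_le y S q J a m hy0 hy1 hq1 hSpos hla.1 (by rw [← hS']; exact hla.2.2) hSm hmJ
            calc usage y S' (J + 1) a (m + 1) * (ρ a * f 0 m) = ρ a * (usage y S' (J + 1) a (m + 1) * f 0 m) := by ring
              _ ≤ ρ a * (usage y S J 0 m * f 0 m) :=
                mul_le_mul_of_nonneg_left (mul_le_mul_of_nonneg_right hus hp.le) (hρ0 a)
        · rw [if_neg hla, mul_zero, hρz a hla, zero_mul]
      calc ∑ a ∈ Finset.range (J + 1 + 1), usage y S' (J + 1) a (m + 1) *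
              (if (1 ≤ a ∧ a ≤ J + 1 ∧ 2 * (a : ℝ) < S') then ρ a * slot (m + 1) else 0)
          ≤ ∑ a ∈ Finset.range (J + 1 + 1), ρ a * (usage y S J 0 m * f 0 m) := Finset.sum_le_sum hbd
        _ = (∑ a ∈ Finset.range (J + 1 + 1), ρ a) * (usage y S J 0 m * f 0 m) := by rw [Finset.sum_mul]
        _ ≤ 1 * (usage y S J 0 m * f 0 m) :=
            mul_le_mul_of_nonneg_right (by rw [hρsum]; exact hQD1) (hterm 0 m)
        _ = usage y S J 0 m * f 0 m := one_mul _
    have hsplitν : ∑ l ∈ Finset.range (J + 1), usage y S J l m * f l m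
        = ∑ l ∈ Finset.range (J + 1), (if 1 ≤ l then usage y S J l m * f l m else 0)
          + usage y S J 0 m * f 0 m := by
      have e : ∀ l ∈ Finset.range (J + 1), usage y S J l m * f l m
          = (if 1 ≤ l then usage y S J l m * f l m else 0) + (if l = 0 then usage y S J l m * f l m else 0) := by
        intro l _
        by_cases hl : 1 ≤ l
        · rw [if_pos hl, if_neg (by omega), add_zero]
        · rw [if_neg hl, if_pos (by omega), zero_add]
      rw [Finset.sum_congr rfl e, Finset.sum_add_distrib, Finset.sum_ite_eq' (Finset.range (J + 1)) 0,
        if_pos (Finset.mem_range.2 (Nat.succ_pos J))]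
    have hφsplit : ∑ a ∈ Finset.range (J + 1 + 1), usage y S' (J + 1) a (m + 1) * φ a (m + 1)
        = ∑ a ∈ Finset.range (J + 1 + 1), usage y S' (J + 1) a (m + 1) * mid a (m + 1)
          + ∑ a ∈ Finset.range (J + 1 + 1), usage y S' (J + 1) a (m + 1) *
              (if (1 ≤ a ∧ a ≤ J + 1 ∧ 2 * (a : ℝ) < S') then ρ a * slot (m + 1) else 0) := by
      rw [← Finset.sum_add_distrib]
      exact Finset.sum_congr rfl fun a _ => by simp only [hφ]; ring
    rw [hφsplit, hsplitν]
    exact add_le_add hT1 hT2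
  refine ⟨φ, hφ0, hφsupp, hφz, hcolφ, fun a hla => by linarith [hrowφ a hla, hρz_le a], ?_⟩
  by_cases hcase : zmid ≤ Q
  · -- slots full: the unplaced mass plus the gate-zero fits into the certified giant room
    left
    have hlhs : ∑ a ∈ Finset.range (J + 1 + 1),
        (if (1 ≤ a ∧ a ≤ J + 1 ∧ 2 * (a : ℝ) < S') then L a - ∑ k ∈ Finset.range (M + 1 + 1), φ a k else 0)
          = Q - zmid := by
      have e : ∀ a ∈ Finset.range (J + 1 + 1),
          (if (1 ≤ a ∧ a ≤ J + 1 ∧ 2 * (a : ℝ) < S') then L a - ∑ k ∈ Finset.range (M + 1 + 1), φ a k else 0)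
            = R a - ρ a * zmid := by
        intro a _
        by_cases hla : (1 ≤ a ∧ a ≤ J + 1 ∧ 2 * (a : ℝ) < S')
        · rw [if_pos hla, hrowφ a hla]
        · rw [if_neg hla, hRz a hla, hρz a hla]; ring
      rw [Finset.sum_congr rfl e, Finset.sum_sub_distrib, ← Finset.sum_mul, ← hQ, hρsum]
      have hkey : Q / D * zmid = zmid := by
        have hDQ : D = Q := max_eq_left hcase
        rcases hQ0.eq_or_lt with hz | hpos
        · have hz0 : zmid = 0 := le_antisymm (by rw [hz]; exact hcase) hzmid0
          rw [hz0, mul_zero]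
        · rw [hDQ, div_self (ne_of_gt hpos), one_mul]
      rw [hkey]
    rw [hlhs]
    have hper : ∀ h ∈ Finset.Ico (J + 1) (M + 1), uy * ∑ l ∈ Finset.range (J + 1), f l h ≤ ν h := by
      intro h hh
      rw [Finset.mem_Ico] at hh
      have hc := hcap h (by omega) (Or.inl hh.1)
      have e : ∑ l ∈ Finset.range (J + 1), usage y S J l h * f l h = uy * ∑ l ∈ Finset.range (J + 1), f l h := by
        rw [Finset.mul_sum]
        exact Finset.sum_congr rfl fun l _ => by rw [usage_giant_eq y S J l h hh.1]
      rw [e] at hc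
      exact hc
    have hsum := Finset.sum_le_sum hper
    rw [← Finset.mul_sum, Finset.sum_comm] at hsum
    refine le_trans (mul_le_mul_of_nonneg_left ?_ huy0.le) hsum
    rw [Finset.sum_range_succ' (fun l => ∑ h ∈ Finset.Ico (J + 1) (M + 1), f l h), hzG]
    have hRle : ∀ l ∈ Finset.range J, R (l + 1 + 1) ≤ ∑ h ∈ Finset.Ico (J + 1) (M + 1), f (l + 1) h := by
      intro l hl
      rw [Finset.mem_range] at hl
      by_cases hla : (1 ≤ l + 1 + 1 ∧ l + 1 + 1 ≤ J + 1 ∧ 2 * (((l + 1 + 1 : ℕ)) : ℝ) < S')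
      · rw [hR2 _ hla (by omega), sum_range_ite_ge_eq_Ico]
        simp only [Nat.add_sub_cancel, le_refl]
      · rw [hRz _ hla]
        exact Finset.sum_nonneg fun h _ => hf0 _ _
    have hQle : Q ≤ q * μ 0 + ∑ l ∈ Finset.range J, ∑ h ∈ Finset.Ico (J + 1) (M + 1), f (l + 1) h := by
      rw [hQ, Finset.sum_range_succ', hRz 0 (fun h => absurd h.1 (by omega)), add_zero,
        Finset.sum_range_succ' (fun a => R (a + 1))]
      simp only [Nat.zero_add]
      have hR1le : R 1 ≤ q * μ 0 := by
        by_cases hla : (1 ≤ 1 ∧ 1 ≤ J + 1 ∧ 2 * ((1 : ℕ) : ℝ) < S')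
        · rw [hR1 hla]
        · rw [hRz 1 hla]; exact mul_nonneg hq0.le (hμ0 0)
      have := Finset.sum_le_sum hRle
      linarith
    rw [hν0]
    linarith
  · -- `Q < z_mid`: every nonzero low is fully placed
    right
    have hQlt : Q < zmid := not_le.1 hcase
    have hzpos : 0 < zmid := lt_of_le_of_lt hQ0 hQlt
    have hDz : D = zmid := max_eq_right hQlt.le
    intro a hla
    have h := hrowφ a hla
    have hρa : ρ a * zmid = R a := by
      simp only [hρ]; rw [hDz, div_mul_cancel₀ _ (ne_of_gt hzpos)]
    linarith

end LawDec

end Quant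

end Summit.CriticalPhenomena.PercolationContinuityZ3.Theorems
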